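import Literature.NumberTheory.LFunctions.LittlewoodZeroGapsProofs
import Literature.NumberTheory.LFunctions.RudnickSarnakZeros
import HarnessLib

/-!
# Littlewood's theorem in the ordinate vocabulary: `γ_{n+1} − γ_n → 0`

Trunk T-ANT (`Literature/NumberTheory/LFunctions`).  Titchmarsh, *The Theory of the Riemann Zeta-Function*, 2nd ed.,
Theorem 9.11 as printed: «the gaps between the ordinates of successive zeros of `ζ(s)` tend to `0`», stated over the tree's
enumeration `zetaOrdinate : ℕ → ℝ` of the positive ordinates (`ZetaZeros.lean`, counted with multiplicity, non-decreasing):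

* `LittlewoodZeroGaps.zetaZeroCount_add_one_le_of_zero` — a zero with ordinate in `(a, b]` raises the count: `N(a) + 1 ≤ N(b)`;
* `LittlewoodZeroGaps.zetaOrdinate_succ_sub_le` — `∀ ε > 0`, eventually `γ_{n+1} − γ_n ≤ ε`;
* `tendsto_zetaOrdinate_succ_sub_zetaOrdinate` — `γ_{n+1} − γ_n → 0`.

Proof: from `littlewood_zero_ordinate_gaps_shrink_holds` (`LittlewoodZeroGapsProofs.lean`: every large `T` is within `ε` of a
zero ordinate) at `T = γ_n + 2ε`: a zero ordinate lies in `[γ_n + ε, γ_n + 3ε]`, so `N(γ_n + 3ε) ≥ N(γ_n) + 1 ≥ n + 2` and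
`γ_{n+1} ≤ γ_n + 3ε` by the dictionary `γ_m ≤ t ↔ m + 1 ≤ N(t)` (`riemann_von_mangoldt.zetaOrdinate_le_iff`).
Sorry-free, standard axioms; no instances, no notation.  Provenance: cell rh-split, seat rh-split-typer-2 g4.
-/

noncomputable section

open Filter Topology

namespace Literature.NumberTheory.LFunctions

namespace LittlewoodZeroGaps

/-- A zero `s` of `ζ` with `0 < Im s` and `a < Im s ≤ b` raises the zero count: `N(a) + 1 ≤ N(b)` (zeros are counted with
their positive multiplicities). [cite: Titchmarsh1986, §9.1] -/
theorem zetaZeroCount_add_one_le_of_zero {s : ℂ} {a b : ℝ} (hs : riemannZeta s = 0) (h0 : 0 < s.im)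
    (ha : a < s.im) (hb : s.im ≤ b) : zetaZeroCount a + 1 ≤ zetaZeroCount b := by
  classical
  have hab : a ≤ b := ha.le.trans hb
  have hmem : s ∈ zetaZeroBox 0 b := DiophantineGeometry.mem_zetaZeroBox_of_riemannZeta_eq_zero hs h0 hb
  have hsub : zetaZeroBox 0 a ⊆ zetaZeroBox 0 b := by
    rintro ρ ⟨h1, h2, h3, h4, h5⟩
    exact ⟨h1, h2, h3, h4, h5.trans hab⟩
  have hnot : s ∉ zetaZeroBox 0 a := fun h ↦ (not_le.2 ha) h.2.2.2.2
  have key := finsum_riemannZetaZeroOrder_add_card_le (A := zetaZeroBox 0 a) (zetaZeroBox_finite 0 b) hsub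
    (fun ρ hρ ↦ DiophantineGeometry.riemannZetaZeroOrder_pos_of_mem_zetaZeroBox hρ) {s}
    (by
      rw [Finset.coe_singleton, Set.singleton_subset_iff]
      exact ⟨hmem, hnot⟩)
  rw [Finset.card_singleton, Nat.cast_one] at key
  have hA : 0 ≤ ∑ᶠ ρ ∈ zetaZeroBox 0 a, riemannZetaZeroOrder ρ :=
    finsum_nonneg fun ρ ↦ finsum_nonneg fun hρ ↦ riemannZetaZeroOrder_nonneg_of_mem_zetaZeroBox hρ
  unfold zetaZeroCount zetaZeroCountRe
  omega

/-- **Titchmarsh Thm 9.11, `ε`-form over the enumeration:** for every `ε > 0`, `γ_{n+1} − γ_n ≤ ε` for all large `n`.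
[cite: Titchmarsh1986, Thm 9.11] -/
theorem zetaOrdinate_succ_sub_le (ε : ℝ) (hε : 0 < ε) :
    ∃ N : ℕ, ∀ n : ℕ, N ≤ n → zetaOrdinate (n + 1) - zetaOrdinate n ≤ ε := by
  have hε3 : 0 < ε / 3 := by positivity
  obtain ⟨T₁, hT₁⟩ := littlewood_zero_ordinate_gaps_shrink_holds (ε / 3) hε3
  obtain ⟨N, hN⟩ := eventually_atTop.1 (tendsto_zetaOrdinate_atTop.eventually_ge_atTop T₁)
  refine ⟨N, fun n hn ↦ ?_⟩
  have hγT : T₁ ≤ zetaOrdinate n := hN n hn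
  have hγ0 : 0 < zetaOrdinate n := zetaOrdinate_pos_holds n
  -- a zero ordinate within `ε/3` of `T = γ_n + 2ε/3`
  obtain ⟨ρ, hρ, hρT⟩ := hT₁ (zetaOrdinate n + 2 * (ε / 3)) (by linarith)
  obtain ⟨hζ, -, -⟩ := mem_riemannZetaNontrivialZeros_iff_holds.1 hρ
  have h1 := abs_le.1 hρT
  have hlo : zetaOrdinate n < ρ.im := by linarith [h1.1]
  have hhi : ρ.im ≤ zetaOrdinate n + ε := by linarith [h1.2]
  have him0 : 0 < ρ.im := hγ0.trans hlo
  -- counting: `N(γ_n) ≥ n + 1`, hence `N(γ_n + ε) ≥ n + 2`, hence `γ_{n+1} ≤ γ_n + ε`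
  have hcount : n + 1 ≤ zetaZeroCount (zetaOrdinate n) :=
    riemann_von_mangoldt_holds.zetaOrdinate_le_iff.1 le_rfl
  have hcount' : n + 1 + 1 ≤ zetaZeroCount (zetaOrdinate n + ε) :=
    le_trans (by omega) (zetaZeroCount_add_one_le_of_zero hζ him0 hlo hhi)
  have hle : zetaOrdinate (n + 1) ≤ zetaOrdinate n + ε :=
    riemann_von_mangoldt_holds.zetaOrdinate_le_iff.2 hcount'
  linarith

end LittlewoodZeroGaps

/-- **Littlewood's theorem (Titchmarsh Thm 9.11) over the tree's enumeration of ordinates:** `γ_{n+1} − γ_n → 0`.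
[cite: Titchmarsh1986, Thm 9.11] -/
theorem tendsto_zetaOrdinate_succ_sub_zetaOrdinate :
    Tendsto (fun n : ℕ ↦ zetaOrdinate (n + 1) - zetaOrdinate n) atTop (𝓝 0) := by
  rw [Metric.tendsto_atTop]
  intro ε hε
  obtain ⟨N, hN⟩ := LittlewoodZeroGaps.zetaOrdinate_succ_sub_le (ε / 2) (by positivity)
  refine ⟨N, fun n hn ↦ ?_⟩
  have h0 : 0 ≤ zetaOrdinate (n + 1) - zetaOrdinate n :=
    sub_nonneg.2 (zetaOrdinate_mono_holds (Nat.le_succ n))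
  rw [Real.dist_eq, sub_zero, abs_of_nonneg h0]
  linarith [hN n hn]

end Literature.NumberTheory.LFunctions

end
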